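import Literature.NumberTheory.IwasawaTheory.CyclotomicTwoLayerFourNonNormUnit
import Literature.NumberTheory.IwasawaTheory.ClassicalMuVanishesQuadraticStepNonNormUnitTwo
import Literature.NumberTheory.IwasawaTheory.ZpExtensionLayerRamifiedPrimesBound
import Literature.NumberTheory.NumberFields.DihedralUnitIdentities
import HarnessLib

/-!
# THE LAYER-THREE UNIT DOOR WITH A BASE-FIELD CERTIFICATE (`p = 2`): sixteen elements of `𝓞_K` — a unit `η` of `K_3 = K·ℚ(ζ₃₂)⁺` with its inverse in tower
# coordinates — whose norm `N_{K_3/K}(η) ≢ ±1 (mod 𝔭₁⁶)` ⟹ `rank₂ Cl(K_m) ≤ 14 ∀ m`, `μ₂ = 0`, `λ₂ ≤ 14`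

Topic `NumberTheory/IwasawaTheory` (namespace = path).  THEOREM-ONLY file (no definition, no named fact, no instance, no `sorry`), written by the prover seat
`bsd-line-att-p3` g50 (cell `bsd-f1-sign2`, WIDTH-5 attach on route `AlignedTransportAtTwo`, crux C2 stmt-BirchSwinnertonDyer-22298; `--supports`, closes nothing).
It assembles att-p4 g42's QUADRATIC-STEP UNIT DOOR `classicalMuVanishes_two_of_unit_not_mem_norm_layer_succ` (`ClassicalMuVanishesQuadraticStepNonNormUnitTwo.lean`)
at `k = 3` with this seat's LEVEL-`64` DYADIC LEMMA (`CyclotomicTwoLayerFourNonNormUnit.unitsIncl_layer_three_not_mem_map_norm_layer_four`) into a door whose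
inputs are DATA IN `𝓞_K` ONLY, in the shape of att-p4 g36's layer-two unit-certificate door (`ClassicalMuVanishesLayerTwoUnitCertificateTwo.lean`): so that the cell's
`1259` / `14891` rows (att-p4 g42 census: `Cl(K_3)[2^∞] ≅ (ℤ/2)⁵`, a unit `η ∈ E_{K_3}` with `N_{K_3/K}(η) = −ε⁴`, `ε ≡ 9 (mod 16)` at `𝔭₁`) reduce to identities in
`ℤ[θ]`.

THE DOOR (`classicalMuVanishes_two_of_layerThree_unitNormCert`).  `K` a number field of odd degree with `2 ∤ d_K`, `2 ∤ h_K` (`classNumberPExp κ 0 = 0`),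
`ord₂ h(K_1) ≤ 1`, at most two primes above `2`; `κ` a cyclotomic `ℤ₂`-extension with Fukuda index `0`; `𝔭₁` a maximal ideal of `𝓞_K` with `𝓞_K/𝔭₁ = 𝔽₂`,
`2 ∈ 𝔭₁ ∖ 𝔭₁²`.  DATA: `c₀,…,c₇, d₀,…,d₇ ∈ 𝓞_K` with the eight coordinate identities of `(Σ cᵢbᵢ)(Σ dᵢbᵢ) = 1` on the tower basis
`b = (1, s₁, s₂, s₁s₂, s₃, s₁s₃, s₂s₃, s₁s₂s₃)` (att-p4 g41's product rule `coord8_mul_of_tower`) — so `η = Σ cᵢbᵢ` is a unit of `𝓞_{K_3}` for EVERY choice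
of the generators — and `U = T^U(c)`, `V = T^V(U)` the three-step norm templates (att-p3 g49's `Algebra.norm_tower3_eq`: `N_{K_3/K}(η) = V₀² − 2V₁²`) with
**`V₀² − 2V₁² − 1 ∉ 𝔭₁⁶` and `V₀² − 2V₁² + 1 ∉ 𝔭₁⁶`**.  THEN `rank₂ Cl(K_m) ≤ 14` for every `m`, `μ₂(κ) = 0`, `λ₂(κ) ≤ 14`.
For `N_{K_3/K}(η) = −ε⁴` with `t = 3` the two non-memberships are `CyclotomicTwoLayerFourNonNormUnit.pow_four_sub_one_not_mem_pow_six` +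
      `Ideal.neg_mem_iff`
(`classicalMuVanishes_two_of_layerThree_unitNormCert_of_neg_pow_four`).

HONEST SCOPE: assembly of tree theorems (no new mathematics); no class group is computed and no certificate for any field is asserted here — the rows are a
data-seat task (att-p4 lineage: `L3CERT-att-p4-g42-data/data/unitdoor_n1259.json`); BSD is not advanced by this file.

References: [Washington1997] §13.1, §13.3 Prop. 13.22–13.23; [Lang1990] Ch. 13 §4 Lemma 4.1; [Fukuda1994] Thm. 1; [NeukirchANT1999] Ch. I §2, Ch. V §1;
[Omeara1963] §63A–B.
-/

set_option autoImplicit false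

noncomputable section

namespace Literature.NumberTheory.IwasawaTheory

open scoped NumberField nonZeroDivisors
open NumberField IsDedekindDomain Field Module
open Literature.NumberTheory.EllipticCurves Literature.NumberTheory.NumberFields Literature.NumberTheory.NumberFields.SqrtTwoTowerFour
  Literature.NumberTheory.NumberFields.DihedralUnits
  Literature.NumberTheory.GaloisRepresentations Literature.NumberTheory.GaloisRepresentations.Herbrand
  Literature.NumberTheory.GaloisRepresentations.MinkowskiUnit Literature.NumberTheory.GaloisRepresentations.CyclicNormIndex

variable {K : Type} [Field K] [NumberField K]

set_option maxHeartbeats 1600000 in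
/-- ★★★ **THE LAYER-THREE UNIT DOOR WITH A BASE-FIELD CERTIFICATE.**  See the file header: sixteen elements `cᵢ, dᵢ ∈ 𝓞_K` (a unit `η = Σ cᵢbᵢ` of `K_3` with inverse
`Σ dᵢbᵢ`, eight product identities), the norm templates `U, V` with `V₀² − 2V₁² ∓ 1 ∉ 𝔭₁⁶` (`𝔭₁` dyadic, `e = f = 1`), over an odd-degree `K` with `2 ∤ d_K`,
`2 ∤ h_K`, `ord₂ h(K_1) ≤ 1`, at most two primes above `2`, `κ` cyclotomic with Fukuda index `0` ⟹ **`rank₂ Cl(K_m) ≤ 14 ∀ m`, `μ₂ = 0`, `λ₂ ≤ 14`**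
(`η ∉ N_{K_4/K_3}K_4ˣ` by the level-`64` lemma, then att-p4 g42's quadratic-step unit door at `k = 3`).
[cite: Washington1997, §13.3 Prop. 13.22–13.23] [cite: Lang1990, Ch. 13 §4, Lemma 4.1 (PDF p. 203)] [cite: Fukuda1994, Thm. 1, p. 264]
[cite: NeukirchANT1999, Ch. V §1 (norm group of `ℚ₂(ζ₆₄)`)] -/
theorem classicalMuVanishes_two_of_layerThree_unitNormCert (hK : ¬ 2 ∣ Module.finrank ℚ K) (hd : ¬ (2 : ℤ) ∣ NumberField.discr K)
    (κ : ZpExtension K 2) (hκ : κ.IsCyclotomic) (hram : TotallyRamifiedFrom κ 0)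
    (h0 : classNumberPExp κ 0 = 0) (h1 : classNumberPExp κ 1 ≤ 1)
    (h2primes : {v : HeightOneSpectrum (𝓞 K) | ((2 : ℕ) : 𝓞 K) ∈ v.asIdeal}.ncard ≤ 2)
    [NumberField (κ.layer 3)] [NumberField (κ.layer (3 + 1))]
    (P : Ideal (𝓞 K)) [P.IsMaximal] (hP0 : P ≠ ⊥) (hres : ∀ r : 𝓞 K, r ∈ P ∨ r - 1 ∈ P) (h2P : (2 : 𝓞 K) ∈ P) (h2P' : (2 : 𝓞 K) ∉ P ^ 2)
    {c₀ c₁ c₂ c₃ c₄ c₅ c₆ c₇ d₀ d₁ d₂ d₃ d₄ d₅ d₆ d₇ U₀ U₁ U₂ U₃ V₀ V₁ : 𝓞 K}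
    (hm₀ : c₀ * d₀ + 2 * c₁ * d₁ + 2 * c₂ * d₂ + 2 * c₂ * d₃ + 2 * c₃ * d₂ + 4 * c₃ * d₃ + 2 * c₄ * d₄ + 2 * c₄ * d₆ + 2 * c₄ * d₇ + 4 * c₅ * d₅ +
          2 * c₅ * d₆ + 4 * c₅ * d₇ + 2 * c₆ * d₄ + 2 * c₆ * d₅ + 4 * c₆ * d₆ + 4 * c₆ * d₇ + 2 * c₇ * d₄ + 4 * c₇ * d₅ + 4 * c₇ * d₆ +
          8 * c₇ * d₇ = 1)
    (hm₁ : c₀ * d₁ + c₁ * d₀ + c₂ * d₂ + 2 * c₂ * d₃ + 2 * c₃ * d₂ + 2 * c₃ * d₃ + 2 * c₄ * d₅ + c₄ * d₆ + 2 * c₄ * d₇ + 2 * c₅ * d₄ + 2 * c₅ * d₆ +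
          2 * c₅ * d₇ + c₆ * d₄ + 2 * c₆ * d₅ + 2 * c₆ * d₆ + 4 * c₆ * d₇ + 2 * c₇ * d₄ + 2 * c₇ * d₅ + 4 * c₇ * d₆ + 4 * c₇ * d₇ = 0)
    (hm₂ : c₀ * d₂ + 2 * c₁ * d₃ + c₂ * d₀ + 2 * c₃ * d₁ + c₄ * d₄ + 2 * c₄ * d₆ + 2 * c₅ * d₅ + 4 * c₅ * d₇ + 2 * c₆ * d₄ + 2 * c₆ * d₆ +
          2 * c₆ * d₇ + 4 * c₇ * d₅ + 2 * c₇ * d₆ + 4 * c₇ * d₇ = 0)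
    (hm₃ : c₀ * d₃ + c₁ * d₂ + c₂ * d₁ + c₃ * d₀ + c₄ * d₅ + 2 * c₄ * d₇ + c₅ * d₄ + 2 * c₅ * d₆ + 2 * c₆ * d₅ + c₆ * d₆ + 2 * c₆ * d₇ +
          2 * c₇ * d₄ + 2 * c₇ * d₆ + 2 * c₇ * d₇ = 0)
    (hm₄ : c₀ * d₄ + 2 * c₁ * d₅ + 2 * c₂ * d₆ + 2 * c₂ * d₇ + 2 * c₃ * d₆ + 4 * c₃ * d₇ + c₄ * d₀ + 2 * c₅ * d₁ + 2 * c₆ * d₂ + 2 * c₆ * d₃ +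
          2 * c₇ * d₂ + 4 * c₇ * d₃ = 0)
    (hm₅ : c₀ * d₅ + c₁ * d₄ + c₂ * d₆ + 2 * c₂ * d₇ + 2 * c₃ * d₆ + 2 * c₃ * d₇ + c₄ * d₁ + c₅ * d₀ + c₆ * d₂ + 2 * c₆ * d₃ + 2 * c₇ * d₂ +
          2 * c₇ * d₃ = 0)
    (hm₆ : c₀ * d₆ + 2 * c₁ * d₇ + c₂ * d₄ + 2 * c₃ * d₅ + c₄ * d₂ + 2 * c₅ * d₃ + c₆ * d₀ + 2 * c₇ * d₁ = 0)
    (hm₇ : c₀ * d₇ + c₁ * d₆ + c₂ * d₅ + c₃ * d₄ + c₄ * d₃ + c₅ * d₂ + c₆ * d₁ + c₇ * d₀ = 0)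
    (hU₀ : U₀ = -8 * c₇ ^ 2 - 8 * c₆ * c₇ - 4 * c₆ ^ 2 - 8 * c₅ * c₇ - 4 * c₅ * c₆ - 4 * c₅ ^ 2 - 4 * c₄ * c₇ - 4 * c₄ * c₆ - 2 * c₄ ^ 2 +
          4 * c₃ ^ 2 + 4 * c₂ * c₃ + 2 * c₂ ^ 2 + 2 * c₁ ^ 2 + c₀ ^ 2)
    (hU₁ : U₁ = -4 * c₇ ^ 2 - 8 * c₆ * c₇ - 2 * c₆ ^ 2 - 4 * c₅ * c₇ - 4 * c₅ * c₆ - 4 * c₄ * c₇ - 2 * c₄ * c₆ - 4 * c₄ * c₅ + 2 * c₃ ^ 2 +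
          4 * c₂ * c₃ + c₂ ^ 2 + 2 * c₀ * c₁)
    (hU₂ : U₂ = -4 * c₇ ^ 2 - 4 * c₆ * c₇ - 2 * c₆ ^ 2 - 8 * c₅ * c₇ - 2 * c₅ ^ 2 - 4 * c₄ * c₆ - c₄ ^ 2 + 4 * c₁ * c₃ + 2 * c₀ * c₂)
    (hU₃ : U₃ = -2 * c₇ ^ 2 - 4 * c₆ * c₇ - c₆ ^ 2 - 4 * c₅ * c₆ - 4 * c₄ * c₇ - 2 * c₄ * c₅ + 2 * c₁ * c₂ + 2 * c₀ * c₃)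
    (hV₀ : V₀ = -4 * U₃ ^ 2 - 4 * U₂ * U₃ - 2 * U₂ ^ 2 + 2 * U₁ ^ 2 + U₀ ^ 2)
    (hV₁ : V₁ = -2 * U₃ ^ 2 - 4 * U₂ * U₃ - U₂ ^ 2 + 2 * U₀ * U₁)
    (hx1 : V₀ ^ 2 - 2 * V₁ ^ 2 - 1 ∉ P ^ 6) (hx2 : V₀ ^ 2 - 2 * V₁ ^ 2 + 1 ∉ P ^ 6) :
    (∀ m, classGroupPRank κ m ≤ 14) ∧ ClassicalMuVanishes κ ∧ classicalLambda κ ≤ 14 := by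
  classical
  haveI : Fact (Nat.Prime 2) := ⟨Nat.prime_two⟩
  have h12 : κ.layer 1 ≤ κ.layer 2 := κ.layer_mono one_le_two
  have h23 : κ.layer 2 ≤ κ.layer 3 := κ.layer_mono (by norm_num)
  have h13 : κ.layer 1 ≤ κ.layer 3 := h12.trans h23
  have h34 : κ.layer 3 ≤ κ.layer (3 + 1) := κ.layer_mono (Nat.le_succ 3)
  letI alg12 : Algebra (κ.layer 1) (κ.layer 2) := (IntermediateField.inclusion h12).toRingHom.toAlgebra
  letI alg23 : Algebra (κ.layer 2) (κ.layer 3) := (IntermediateField.inclusion h23).toRingHom.toAlgebra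
  letI alg13 : Algebra (κ.layer 1) (κ.layer 3) := (IntermediateField.inclusion h13).toRingHom.toAlgebra
  letI alg34 : Algebra (κ.layer 3) (κ.layer (3 + 1)) := (IntermediateField.inclusion h34).toRingHom.toAlgebra
  haveI tow12 : IsScalarTower K (κ.layer 1) (κ.layer 2) :=
    IsScalarTower.of_algebraMap_eq fun x => ((IntermediateField.inclusion h12).commutes x).symm
  haveI tow23 : IsScalarTower K (κ.layer 2) (κ.layer 3) :=
    IsScalarTower.of_algebraMap_eq fun x => ((IntermediateField.inclusion h23).commutes x).symm
  haveI tow13 : IsScalarTower K (κ.layer 1) (κ.layer 3) :=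
    IsScalarTower.of_algebraMap_eq fun x => ((IntermediateField.inclusion h13).commutes x).symm
  haveI tow34 : IsScalarTower K (κ.layer 3) (κ.layer (3 + 1)) :=
    IsScalarTower.of_algebraMap_eq fun x => ((IntermediateField.inclusion h34).commutes x).symm
  haveI tow123 : IsScalarTower (κ.layer 1) (κ.layer 2) (κ.layer 3) :=
    IsScalarTower.of_algebraMap_eq fun x => (IntermediateField.inclusion_inclusion h12 h23 x).symm
  haveI : FiniteDimensional K (κ.layer 1) := κ.finiteDimensional_layer_holds 1
  haveI : FiniteDimensional K (κ.layer 2) := κ.finiteDimensional_layer_holds 2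
  haveI : FiniteDimensional K (κ.layer 3) := κ.finiteDimensional_layer_holds 3
  haveI : FiniteDimensional K (κ.layer (3 + 1)) := κ.finiteDimensional_layer_holds (3 + 1)
  haveI : NumberField (κ.layer 1) := NumberField.of_module_finite K _
  haveI : NumberField (κ.layer 2) := NumberField.of_module_finite K _
  haveI : IsGalois K (κ.layer 1) := κ.isGalois_layer_holds 1
  haveI : IsGalois K (κ.layer 2) := κ.isGalois_layer_holds 2
  haveI : IsGalois K (κ.layer 3) := κ.isGalois_layer_holds 3
  haveI : IsGalois K (κ.layer (3 + 1)) := κ.isGalois_layer_holds (3 + 1)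
  haveI : IsGalois (κ.layer 1) (κ.layer 2) := IsGalois.tower_top_of_isGalois K _ _
  haveI : IsGalois (κ.layer 2) (κ.layer 3) := IsGalois.tower_top_of_isGalois K _ _
  haveI : IsGalois (κ.layer 3) (κ.layer (3 + 1)) := IsGalois.tower_top_of_isGalois K _ _
  haveI : FiniteDimensional (κ.layer 1) (κ.layer 2) := Module.Finite.of_restrictScalars_finite K _ _
  haveI : FiniteDimensional (κ.layer 2) (κ.layer 3) := Module.Finite.of_restrictScalars_finite K _ _
  haveI : FiniteDimensional (κ.layer 3) (κ.layer (3 + 1)) := Module.Finite.of_restrictScalars_finite K _ _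
  have hdeg1 : Module.finrank K (κ.layer 1) = 2 := by rw [κ.finrank_layer_holds 1, pow_one]
  have hdeg2 : Module.finrank (κ.layer 1) (κ.layer 2) = 2 := by rw [finrank_layer_layer κ one_le_two]; norm_num
  have hdeg3 : Module.finrank (κ.layer 2) (κ.layer 3) = 2 := by rw [finrank_layer_layer κ (show 2 ≤ 3 by norm_num)]; norm_num
  obtain ⟨s₁, s₂, s₃, hs₁, hs₂, hs₃, hs₁K, hs₂K, hs₃K⟩ := exists_generators_three_layers hK hd κ hκ
  -- the relations in `K_3`
  have hR₁ : (algebraMap (κ.layer 1) (κ.layer 3) s₁) ^ 2 = 2 := by rw [← map_pow, hs₁, map_ofNat]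
  have hR₂ : (algebraMap (κ.layer 2) (κ.layer 3) s₂) ^ 2 = 2 + algebraMap (κ.layer 1) (κ.layer 3) s₁ := by
    rw [← map_pow, hs₂, ← IsScalarTower.algebraMap_apply, map_add, map_ofNat]
  have hR₃ : s₃ ^ 2 = 2 + algebraMap (κ.layer 2) (κ.layer 3) s₂ := by rw [hs₃, map_add, map_ofNat]
  set R₁ := algebraMap (κ.layer 1) (κ.layer 3) s₁ with hR₁def
  set R₂ := algebraMap (κ.layer 2) (κ.layer 3) s₂ with hR₂def
  -- the unit `η` of `K_3` and its inverse
  set f : 𝓞 K → κ.layer 3 := fun r => algebraMap K (κ.layer 3) (algebraMap (𝓞 K) K r) with hf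
  have hfmul : ∀ a b : 𝓞 K, f (a * b) = f a * f b := fun a b => by simp only [hf, map_mul]
  have hfadd : ∀ a b : 𝓞 K, f (a + b) = f a + f b := fun a b => by simp only [hf, map_add]
  set ηK : κ.layer 3 := f c₀ + f c₁ * algebraMap (κ.layer 1) (κ.layer 3) s₁ + (f c₂ +
        f c₃ * algebraMap (κ.layer 1) (κ.layer 3) s₁) * algebraMap (κ.layer 2) (κ.layer 3) s₂ + (f c₄ +
        f c₅ * algebraMap (κ.layer 1) (κ.layer 3) s₁ + (f c₆ +
        f c₇ * algebraMap (κ.layer 1) (κ.layer 3) s₁) * algebraMap (κ.layer 2) (κ.layer 3) s₂) * s₃ with hηK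
  set ηK' : κ.layer 3 := f d₀ + f d₁ * algebraMap (κ.layer 1) (κ.layer 3) s₁ + (f d₂ +
        f d₃ * algebraMap (κ.layer 1) (κ.layer 3) s₁) * algebraMap (κ.layer 2) (κ.layer 3) s₂ + (f d₄ +
        f d₅ * algebraMap (κ.layer 1) (κ.layer 3) s₁ + (f d₆ +
        f d₇ * algebraMap (κ.layer 1) (κ.layer 3) s₁) * algebraMap (κ.layer 2) (κ.layer 3) s₂) * s₃ with hηK'
  have hm₀' := congrArg f hm₀
  have hm₁' := congrArg f hm₁
  have hm₂' := congrArg f hm₂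
  have hm₃' := congrArg f hm₃
  have hm₄' := congrArg f hm₄
  have hm₅' := congrArg f hm₅
  have hm₆' := congrArg f hm₆
  have hm₇' := congrArg f hm₇
  simp only [hf, map_add, map_mul, map_ofNat, map_one, map_zero] at hm₀' hm₁' hm₂' hm₃' hm₄' hm₅' hm₆' hm₇'
  have hmul : ηK * ηK' = 1 := by
    rw [hηK, hηK']
    simp only [hf]
    rw [coord8_mul_of_tower hs₁ hs₂ hs₃]
    simp only [map_add, map_mul, map_ofNat, ← hR₁def, ← hR₂def]
    linear_combination (1) * hm₀' + (R₁) * hm₁' + (R₂) * hm₂' + (R₁ * R₂) * hm₃' + (s₃) * hm₄' + (R₁ * s₃) * hm₅' + (R₂ * s₃) * hm₆' +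
          (R₁ * R₂ * s₃) * hm₇'
  set ηu : (κ.layer 3)ˣ := Units.mkOfMulEqOne ηK ηK' hmul with hηu
  -- `N_{K_3/K}(η) = V₀² − 2V₁²`, a unit of `𝓞_K`
  have eU₀ := congrArg (algebraMap (𝓞 K) K) hU₀
  have eU₁ := congrArg (algebraMap (𝓞 K) K) hU₁
  have eU₂ := congrArg (algebraMap (𝓞 K) K) hU₂
  have eU₃ := congrArg (algebraMap (𝓞 K) K) hU₃
  have eV₀ := congrArg (algebraMap (𝓞 K) K) hV₀
  have eV₁ := congrArg (algebraMap (𝓞 K) K) hV₁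
  simp only [map_add, map_sub, map_mul, map_pow, map_neg, map_ofNat] at eU₀ eU₁ eU₂ eU₃ eV₀ eV₁
  have hnorm : Algebra.norm K ηK = algebraMap (𝓞 K) K (V₀ ^ 2 - 2 * V₁ ^ 2) := by
    rw [hηK]
    simp only [hf]
    rw [Algebra.norm_tower3_eq hdeg1 hdeg2 hdeg3 hs₁ hs₁K hs₂ hs₂K hs₃ hs₃K _ _ _ _ _ _ _ _ eU₀ eU₁ eU₂ eU₃ eV₀ eV₁]
    simp only [map_sub, map_mul, map_pow, map_ofNat]
  -- the norm of the inverse, and `x x' = 1`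
  obtain ⟨x', hx'⟩ : ∃ x' : 𝓞 K, Algebra.norm K ηK' = algebraMap (𝓞 K) K x' := by
    obtain ⟨W₀, hW₀⟩ : ∃ z : 𝓞 K, z = -8 * d₇ ^ 2 - 8 * d₆ * d₇ - 4 * d₆ ^ 2 - 8 * d₅ * d₇ - 4 * d₅ * d₆ - 4 * d₅ ^ 2 - 4 * d₄ * d₇ - 4 * d₄ * d₆ -
          2 * d₄ ^ 2 + 4 * d₃ ^ 2 + 4 * d₂ * d₃ + 2 * d₂ ^ 2 + 2 * d₁ ^ 2 + d₀ ^ 2 := ⟨_, rfl⟩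
    obtain ⟨W₁, hW₁⟩ : ∃ z : 𝓞 K, z = -4 * d₇ ^ 2 - 8 * d₆ * d₇ - 2 * d₆ ^ 2 - 4 * d₅ * d₇ - 4 * d₅ * d₆ - 4 * d₄ * d₇ - 2 * d₄ * d₆ - 4 * d₄ * d₅ +
          2 * d₃ ^ 2 + 4 * d₂ * d₃ + d₂ ^ 2 + 2 * d₀ * d₁ := ⟨_, rfl⟩
    obtain ⟨W₂, hW₂⟩ : ∃ z : 𝓞 K, z = -4 * d₇ ^ 2 - 4 * d₆ * d₇ - 2 * d₆ ^ 2 - 8 * d₅ * d₇ - 2 * d₅ ^ 2 - 4 * d₄ * d₆ - d₄ ^ 2 + 4 * d₁ * d₃ +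
          2 * d₀ * d₂ := ⟨_, rfl⟩
    obtain ⟨W₃, hW₃⟩ : ∃ z : 𝓞 K, z = -2 * d₇ ^ 2 - 4 * d₆ * d₇ - d₆ ^ 2 - 4 * d₅ * d₆ - 4 * d₄ * d₇ - 2 * d₄ * d₅ + 2 * d₁ * d₂ +
          2 * d₀ * d₃ := ⟨_, rfl⟩
    obtain ⟨Z₀, hZ₀⟩ : ∃ z : 𝓞 K, z = -4 * W₃ ^ 2 - 4 * W₂ * W₃ - 2 * W₂ ^ 2 + 2 * W₁ ^ 2 + W₀ ^ 2 := ⟨_, rfl⟩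
    obtain ⟨Z₁, hZ₁⟩ : ∃ z : 𝓞 K, z = -2 * W₃ ^ 2 - 4 * W₂ * W₃ - W₂ ^ 2 + 2 * W₀ * W₁ := ⟨_, rfl⟩
    have eW₀ := congrArg (algebraMap (𝓞 K) K) hW₀
    have eW₁ := congrArg (algebraMap (𝓞 K) K) hW₁
    have eW₂ := congrArg (algebraMap (𝓞 K) K) hW₂
    have eW₃ := congrArg (algebraMap (𝓞 K) K) hW₃
    have eZ₀ := congrArg (algebraMap (𝓞 K) K) hZ₀
    have eZ₁ := congrArg (algebraMap (𝓞 K) K) hZ₁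
    simp only [map_add, map_sub, map_mul, map_pow, map_neg, map_ofNat] at eW₀ eW₁ eW₂ eW₃ eZ₀ eZ₁
    refine ⟨Z₀ ^ 2 - 2 * Z₁ ^ 2, ?_⟩
    rw [hηK']
    simp only [hf]
    rw [Algebra.norm_tower3_eq hdeg1 hdeg2 hdeg3 hs₁ hs₁K hs₂ hs₂K hs₃ hs₃K _ _ _ _ _ _ _ _ eW₀ eW₁ eW₂ eW₃ eZ₀ eZ₁]
    simp only [map_sub, map_mul, map_pow, map_ofNat]
  have hxx : (V₀ ^ 2 - 2 * V₁ ^ 2) * x' = 1 := by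
    apply IsFractionRing.injective (𝓞 K) K
    rw [map_mul, map_one, ← hnorm, ← hx', ← map_mul, hmul, map_one]
  set xu : (𝓞 K)ˣ := Units.mkOfMulEqOne _ _ hxx with hxu
  have hη : Algebra.norm K (ηu : κ.layer 3) = algebraMap (𝓞 K) K xu := by
    rw [hηu, Units.val_mkOfMulEqOne, hxu, Units.val_mkOfMulEqOne, hnorm]
  -- `η ∉ N_{K_4/K_3} K_4ˣ` (the level-64 lemma) and `η ∈ E_{K_4} ∩ K_3ˣ`
  have hnot := unitsIncl_layer_three_not_mem_map_norm_layer_four hK hd κ hκ P hP0 hres h2P h2P' xu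
    (by rw [hxu, Units.val_mkOfMulEqOne]; exact hx1) (by rw [hxu, Units.val_mkOfMulEqOne]; exact hx2) ηu hη
  -- integrality of `η` and `η⁻¹`
  have hi₁ : IsIntegral ℤ R₁ := NestedSqrtTwo.isIntegral (R := ℤ) (n := 1) (θ := R₁) (by
    show R₁ ^ 2 - 2 = 0
    rw [hR₁, sub_self])
  have hi₂ : IsIntegral ℤ R₂ := NestedSqrtTwo.isIntegral (R := ℤ) (n := 2) (θ := R₂) (by
    show (R₂ ^ 2 - 2) ^ 2 - 2 = 0
    rw [hR₂, add_sub_cancel_left, hR₁, sub_self])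
  have hi₃ : IsIntegral ℤ s₃ := NestedSqrtTwo.isIntegral (R := ℤ) (n := 3) (θ := s₃) (by
    show ((s₃ ^ 2 - 2) ^ 2 - 2) ^ 2 - 2 = 0
    rw [hR₃, add_sub_cancel_left, hR₂, add_sub_cancel_left, hR₁, sub_self])
  have hif : ∀ r : 𝓞 K, IsIntegral ℤ (f r) := fun r => by
    simp only [hf]
    exact (r.isIntegral_coe.algebraMap (B := K)).algebraMap
  have hint : IsIntegral ℤ ηK := by
    rw [hηK]
    exact (((hif c₀).add ((hif c₁).mul hi₁)).add (((hif c₂).add ((hif c₃).mul hi₁)).mul hi₂)).add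
      ((((hif c₄).add ((hif c₅).mul hi₁)).add (((hif c₆).add ((hif c₇).mul hi₁)).mul hi₂)).mul hi₃)
  have hint' : IsIntegral ℤ ηK' := by
    rw [hηK']
    exact (((hif d₀).add ((hif d₁).mul hi₁)).add (((hif d₂).add ((hif d₃).mul hi₁)).mul hi₂)).add
      ((((hif d₄).add ((hif d₅).mul hi₁)).add (((hif d₆).add ((hif d₇).mul hi₁)).mul hi₂)).mul hi₃)
  have hE : unitsIncl (κ.layer 3) (κ.layer (3 + 1)) ηu ∈ unitsE (κ.layer (3 + 1)) := by
    rw [mem_unitsE_iff_isIntegral]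
    constructor
    · show IsIntegral ℤ (algebraMap (κ.layer 3) (κ.layer (3 + 1)) (ηu : κ.layer 3))
      rw [hηu, Units.val_mkOfMulEqOne]
      exact hint.algebraMap
    · rw [← map_inv]
      show IsIntegral ℤ (algebraMap (κ.layer 3) (κ.layer (3 + 1)) ((ηu⁻¹ : (κ.layer 3)ˣ) : κ.layer 3))
      rw [hηu]
      exact hint'.algebraMap
  have hu : unitsIncl (κ.layer 3) (κ.layer (3 + 1)) ηu ∈
      unitsE (κ.layer (3 + 1)) ⊓ (unitsIncl (κ.layer 3) (κ.layer (3 + 1))).range := Subgroup.mem_inf.mpr ⟨hE, ηu, rfl⟩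
  have ht : {v : HeightOneSpectrum (𝓞 (κ.layer 3)) | v.asIdeal.ramificationIdxIn (𝓞 (κ.layer (3 + 1))) ≠ 1}.ncard ≤ 2 :=
    (ncard_ramified_layer_succ_le_ncard_primes_above κ hram 3).trans h2primes
  obtain ⟨hr, hmu, hl⟩ := classicalMuVanishes_two_of_unit_not_mem_norm_layer_succ κ hram h0 h1 ht hu hnot
  exact ⟨fun m => (hr m).trans (by norm_num), hmu, hl.trans (by norm_num)⟩

/-- ★★ **The same with the cell's datum `N_{K_3/K}(η) = −ε⁴`, `t = 3`** (`ε ≡ ±1 (mod 𝔭₁³)`, `ε ≢ ±1 (mod 𝔭₁⁴)`; customers `1259`, `14891`):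
`pow_four_sub_one_not_mem_pow_six` supplies `(−ε⁴) ∓ 1 ∉ 𝔭₁⁶`. [cite: Washington1997, §13.3 Prop. 13.22–13.23] [cite: Omeara1963, §63A]
[cite: NeukirchANT1999, Ch. V §1] -/
theorem classicalMuVanishes_two_of_layerThree_unitNormCert_of_neg_pow_four (hK : ¬ 2 ∣ Module.finrank ℚ K) (hd : ¬ (2 : ℤ) ∣ NumberField.discr K)
    (κ : ZpExtension K 2) (hκ : κ.IsCyclotomic) (hram : TotallyRamifiedFrom κ 0)
    (h0 : classNumberPExp κ 0 = 0) (h1 : classNumberPExp κ 1 ≤ 1)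
    (h2primes : {v : HeightOneSpectrum (𝓞 K) | ((2 : ℕ) : 𝓞 K) ∈ v.asIdeal}.ncard ≤ 2)
    [NumberField (κ.layer 3)] [NumberField (κ.layer (3 + 1))]
    (P : Ideal (𝓞 K)) [P.IsMaximal] (hP0 : P ≠ ⊥) (hres : ∀ r : 𝓞 K, r ∈ P ∨ r - 1 ∈ P) (h2P : (2 : 𝓞 K) ∈ P) (h2P' : (2 : 𝓞 K) ∉ P ^ 2)
    {ε : 𝓞 K} (h3 : ε - 1 ∈ P ^ 3 ∨ ε + 1 ∈ P ^ 3) (hε1 : ε - 1 ∉ P ^ 4) (hε2 : ε + 1 ∉ P ^ 4)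
    {c₀ c₁ c₂ c₃ c₄ c₅ c₆ c₇ d₀ d₁ d₂ d₃ d₄ d₅ d₆ d₇ U₀ U₁ U₂ U₃ V₀ V₁ : 𝓞 K}
    (hm₀ : c₀ * d₀ + 2 * c₁ * d₁ + 2 * c₂ * d₂ + 2 * c₂ * d₃ + 2 * c₃ * d₂ + 4 * c₃ * d₃ + 2 * c₄ * d₄ + 2 * c₄ * d₆ + 2 * c₄ * d₇ + 4 * c₅ * d₅ +
          2 * c₅ * d₆ + 4 * c₅ * d₇ + 2 * c₆ * d₄ + 2 * c₆ * d₅ + 4 * c₆ * d₆ + 4 * c₆ * d₇ + 2 * c₇ * d₄ + 4 * c₇ * d₅ + 4 * c₇ * d₆ +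
          8 * c₇ * d₇ = 1)
    (hm₁ : c₀ * d₁ + c₁ * d₀ + c₂ * d₂ + 2 * c₂ * d₃ + 2 * c₃ * d₂ + 2 * c₃ * d₃ + 2 * c₄ * d₅ + c₄ * d₆ + 2 * c₄ * d₇ + 2 * c₅ * d₄ + 2 * c₅ * d₆ +
          2 * c₅ * d₇ + c₆ * d₄ + 2 * c₆ * d₅ + 2 * c₆ * d₆ + 4 * c₆ * d₇ + 2 * c₇ * d₄ + 2 * c₇ * d₅ + 4 * c₇ * d₆ + 4 * c₇ * d₇ = 0)
    (hm₂ : c₀ * d₂ + 2 * c₁ * d₃ + c₂ * d₀ + 2 * c₃ * d₁ + c₄ * d₄ + 2 * c₄ * d₆ + 2 * c₅ * d₅ + 4 * c₅ * d₇ + 2 * c₆ * d₄ + 2 * c₆ * d₆ +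
          2 * c₆ * d₇ + 4 * c₇ * d₅ + 2 * c₇ * d₆ + 4 * c₇ * d₇ = 0)
    (hm₃ : c₀ * d₃ + c₁ * d₂ + c₂ * d₁ + c₃ * d₀ + c₄ * d₅ + 2 * c₄ * d₇ + c₅ * d₄ + 2 * c₅ * d₆ + 2 * c₆ * d₅ + c₆ * d₆ + 2 * c₆ * d₇ +
          2 * c₇ * d₄ + 2 * c₇ * d₆ + 2 * c₇ * d₇ = 0)
    (hm₄ : c₀ * d₄ + 2 * c₁ * d₅ + 2 * c₂ * d₆ + 2 * c₂ * d₇ + 2 * c₃ * d₆ + 4 * c₃ * d₇ + c₄ * d₀ + 2 * c₅ * d₁ + 2 * c₆ * d₂ + 2 * c₆ * d₃ +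
          2 * c₇ * d₂ + 4 * c₇ * d₃ = 0)
    (hm₅ : c₀ * d₅ + c₁ * d₄ + c₂ * d₆ + 2 * c₂ * d₇ + 2 * c₃ * d₆ + 2 * c₃ * d₇ + c₄ * d₁ + c₅ * d₀ + c₆ * d₂ + 2 * c₆ * d₃ + 2 * c₇ * d₂ +
          2 * c₇ * d₃ = 0)
    (hm₆ : c₀ * d₆ + 2 * c₁ * d₇ + c₂ * d₄ + 2 * c₃ * d₅ + c₄ * d₂ + 2 * c₅ * d₃ + c₆ * d₀ + 2 * c₇ * d₁ = 0)
    (hm₇ : c₀ * d₇ + c₁ * d₆ + c₂ * d₅ + c₃ * d₄ + c₄ * d₃ + c₅ * d₂ + c₆ * d₁ + c₇ * d₀ = 0)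
    (hU₀ : U₀ = -8 * c₇ ^ 2 - 8 * c₆ * c₇ - 4 * c₆ ^ 2 - 8 * c₅ * c₇ - 4 * c₅ * c₆ - 4 * c₅ ^ 2 - 4 * c₄ * c₇ - 4 * c₄ * c₆ - 2 * c₄ ^ 2 +
          4 * c₃ ^ 2 + 4 * c₂ * c₃ + 2 * c₂ ^ 2 + 2 * c₁ ^ 2 + c₀ ^ 2)
    (hU₁ : U₁ = -4 * c₇ ^ 2 - 8 * c₆ * c₇ - 2 * c₆ ^ 2 - 4 * c₅ * c₇ - 4 * c₅ * c₆ - 4 * c₄ * c₇ - 2 * c₄ * c₆ - 4 * c₄ * c₅ + 2 * c₃ ^ 2 +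
          4 * c₂ * c₃ + c₂ ^ 2 + 2 * c₀ * c₁)
    (hU₂ : U₂ = -4 * c₇ ^ 2 - 4 * c₆ * c₇ - 2 * c₆ ^ 2 - 8 * c₅ * c₇ - 2 * c₅ ^ 2 - 4 * c₄ * c₆ - c₄ ^ 2 + 4 * c₁ * c₃ + 2 * c₀ * c₂)
    (hU₃ : U₃ = -2 * c₇ ^ 2 - 4 * c₆ * c₇ - c₆ ^ 2 - 4 * c₅ * c₆ - 4 * c₄ * c₇ - 2 * c₄ * c₅ + 2 * c₁ * c₂ + 2 * c₀ * c₃)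
    (hV₀ : V₀ = -4 * U₃ ^ 2 - 4 * U₂ * U₃ - 2 * U₂ ^ 2 + 2 * U₁ ^ 2 + U₀ ^ 2)
    (hV₁ : V₁ = -2 * U₃ ^ 2 - 4 * U₂ * U₃ - U₂ ^ 2 + 2 * U₀ * U₁)
    (hN : V₀ ^ 2 - 2 * V₁ ^ 2 = -ε ^ 4) :
    (∀ m, classGroupPRank κ m ≤ 14) ∧ ClassicalMuVanishes κ ∧ classicalLambda κ ≤ 14 := by
  obtain ⟨h6a, h6b⟩ := pow_four_sub_one_not_mem_pow_six P hP0 hres h2P h2P' h3 hε1 hε2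
  refine classicalMuVanishes_two_of_layerThree_unitNormCert hK hd κ hκ hram h0 h1 h2primes P hP0 hres h2P h2P'
    hm₀ hm₁ hm₂ hm₃ hm₄ hm₅ hm₆ hm₇ hU₀ hU₁ hU₂ hU₃ hV₀ hV₁ ?_ ?_
  · rw [hN, show -ε ^ 4 - 1 = -(ε ^ 4 + 1) by ring, Ideal.neg_mem_iff]; exact h6b
  · rw [hN, show -ε ^ 4 + 1 = -(ε ^ 4 - 1) by ring, Ideal.neg_mem_iff]; exact h6a

end Literature.NumberTheory.IwasawaTheory

end
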